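import Mathlib
import Summits.ResolutionOfSingularities.ResolutionOfSingularities.Theorems.RadicialJungCleanModelsCleanProp44NearLineVertexInsertion
import Summits.ResolutionOfSingularities.ResolutionOfSingularities.Theorems.RadicialJungCleanModelsCleanProp44CrossInsertion
import HarnessLib

/-!
# Route `RadicialJung`, crux `CleanModels` (stmt-ResolutionOfSingularities-15917), line `Sketch` rev 35, stub 6 `stub_cleanProp44` (X44c):
# ONE INSERTION ON A NEAR LINE — the consumer's endpoint: what is left after inserting at an obstruction is a BIRTH of one explicit unit

Seat decomp-res-hand-2 g19 (structural hand).  The endpoints of this generation chained for the (R1ᵐⁱⁿ) prover, starting — like hand-2 g18's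
✓ `cleanPermissibleAt_nearLine_or_vertex_or_cross_of_cleanRegAt` — from the predicate `CleanRegAt` at the blown-up threefold point `x` and a near line
`N = (e', y')` through `x' ∈ E_x`, and ONE MORE point blowing up `σ : X'' → X'` at `x'` with a point `x''` on the strict transforms of `E_x = V(e')` and of
`V(y')` (`σ^♯ e' = E · ε`, `σ^♯ y' = E · ζ`):

* `cleanPermissibleAt_nearLine_insertion_of_cleanRegAt` — there is a clean normal form `(c, cc, u, a)` at `x` and coefficients `m` (`t_{j₀} = Σ m_k c_k`) such
  that EITHER the line is clean-permissible at `x'` for `N` (no insertion needed), OR `x'` is a VERTEX (sides `c_{k₁}, c_{k₂}` through `x'`, `N` not an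
  axis) and after the insertion `(E, ε, ζ) = 𝔪_{x''}`, the transform is `U · ε^{Σ a} · E^{a_{k₁} + a_{k₂} + Σ a}` and the strict transform `N'' = (ε, ζ)`
  is clean-permissible at `x''` unless `p ∣ Σ a`, `p ∣ a_{k₁} + a_{k₂} + Σ a` and `U` is a birth (✓ `cleanPermissibleAt_nearLine_insertion_of_vertex_or_birth`),
  OR `x'` is a BIRTH (`p ∣ Σ a`, no side through `x'`, unit `U` failing the non-birth test at `x'`) and after the insertion `(E, ε, ζ) = 𝔪_{x''}`, the
  transform is `σ^♯ U · ε^{Σ a} · E^{Σ a}`, and `N''` is clean-permissible at `x''` unless the SAME unit `σ^♯ U` is a birth again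
  (✓ `cleanPermissibleAt_strictTransform_of_unitForm_or_birth`).

Honest framing: OURS, bookkeeping (no new mathematics beyond the two insertion theorems).  The termination of insertion chains (memo g18 §2 (d) (iii)) is
thereby the descent of the birth defect of ONE unit — NOT addressed.  Nothing here proves X44c, any case of `CleanModels`, or resolution of singularities in
characteristic `p`.  Setting only: [cite: CossartPiltant2008, Lemma 4.3 (5); Prop. 4.4 (proof, p. 11)] [cite: Piltant2013, §2 Axiom 4].
-/

noncomputable section

set_option linter.dupNamespace false -- mandated namespace of this single-conjunct summit

open IsLocalRing CategoryTheory AlgebraicGeometry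
open Literature.AlgebraicGeometry.Resolution Literature.AlgebraicGeometry.Motives

namespace Summit.ResolutionOfSingularities.ResolutionOfSingularities.Theorems.RadicialJung.CleanModels

universe u

section Scheme

variable {p : ℕ} {X X' X'' : Scheme.{u}} [IsIntegral X] [IsIntegral X'] [IsIntegral X''] {τ : X' ⟶ X} [IsDominant τ]
  {σ : X'' ⟶ X'} [IsDominant σ] {J : X.IdealSheafData} {J' : X'.IdealSheafData}

set_option maxHeartbeats 1600000 in
-- long statement, short proof
/-- **ONE INSERTION ON A NEAR LINE: afterwards only a birth of one explicit unit can obstruct.**  See the module docstring.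
[cite: CossartPiltant2008, Lemma 4.3 (5); Prop. 4.4 (proof, p. 11)] [cite: Piltant2013, §2 Axiom 4] -/
theorem cleanPermissibleAt_nearLine_insertion_of_cleanRegAt [Fact p.Prime] [CharP X.functionField p] (hτ : IsBlowup τ J) (hσ : IsBlowup σ J')
    (x'' : X'') (hJ : stalkIdeal J (τ (σ x'')) = maximalIdeal (X.presheaf.stalk (τ (σ x'')))) {G : X.functionField}
    (hclean : CleanRegAt p (RatFn.toFunctionField (τ (σ x''))) G) (hdim3 : ringKrullDim (X.presheaf.stalk (τ (σ x''))) = (3 : ℕ))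
    (hdim' : ringKrullDim (X'.presheaf.stalk (σ x'')) = 3) (hJ' : stalkIdeal J' (σ x'') = maximalIdeal (X'.presheaf.stalk (σ x'')))
    {d : ℕ} (t : Fin d → X.presheaf.stalk (τ (σ x''))) (hspan : Ideal.span (Set.range t) = maximalIdeal (X.presheaf.stalk (τ (σ x''))))
    (hdimd : ringKrullDim (X.presheaf.stalk (τ (σ x''))) = (d : WithBot ℕ∞)) (j₀ : Fin d) {e' y' : X'.presheaf.stalk (σ x'')}
    (he' : Ideal.span {e'} = (maximalIdeal (X.presheaf.stalk (τ (σ x'')))).map (τ.stalkMap (σ x'')).hom)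
    (hy' : (τ.stalkMap (σ x'')).hom (t j₀) = e' * y') (hpair : IsRsopPart ![e', y'])
    (hdim'' : ringKrullDim (X''.presheaf.stalk x'') = 3) {E ε ζ : X''.presheaf.stalk x''}
    (hE : Ideal.span {E} = (maximalIdeal (X'.presheaf.stalk (σ x''))).map (σ.stalkMap x'').hom)
    (hε : (σ.stalkMap x'').hom e' = E * ε) (hεm : ε ∈ maximalIdeal (X''.presheaf.stalk x''))
    (hζ : (σ.stalkMap x'').hom y' = E * ζ) (hζm : ζ ∈ maximalIdeal (X''.presheaf.stalk x'')) :
    ∃ (c : Fin 3 → X.presheaf.stalk (τ (σ x''))) (cc : Fin p → X.functionField) (u : X.presheaf.stalk (τ (σ x''))) (a : Fin 3 → ℕ)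
      (m : Fin 3 → X.presheaf.stalk (τ (σ x''))),
      Ideal.span (Set.range c) = maximalIdeal (X.presheaf.stalk (τ (σ x''))) ∧ (∃ j : Fin p, (j : ℕ) ≠ 0 ∧ cc j ≠ 0) ∧ IsUnit u ∧
      (∀ k, a k = 0 ∨ ¬ p ∣ a k) ∧ (∑ j : Fin p, cc j ^ p * G ^ (j : ℕ)) = RatFn.toFunctionField (τ (σ x'')) (u * ∏ k, c k ^ a k) ∧
      t j₀ = ∑ k, m k * c k ∧
      (CleanPermissibleAt p (RatFn.toFunctionField (σ x'')) (RatFn.functionFieldMap τ G) (Ideal.span ({e', y'} : Set (X'.presheaf.stalk (σ x'')))) ∨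
      -- VERTEX at `x'`, and what the insertion leaves at `x''`
      (∃ (k₁ k₂ : Fin 3) (s₁ s₂ : X'.presheaf.stalk (σ x'')), k₁ ≠ k₂ ∧ a k₁ ≠ 0 ∧ a k₂ ≠ 0 ∧
          (τ.stalkMap (σ x'')).hom (c k₁) = e' * s₁ ∧ (τ.stalkMap (σ x'')).hom (c k₂) = e' * s₂ ∧
          Ideal.span ({e', s₁, s₂} : Set (X'.presheaf.stalk (σ x''))) = maximalIdeal (X'.presheaf.stalk (σ x'')) ∧
          s₁ ∉ Ideal.span ({e', y'} : Set (X'.presheaf.stalk (σ x''))) ∧ s₂ ∉ Ideal.span ({e', y'} : Set (X'.presheaf.stalk (σ x''))) ∧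
          Ideal.span ({E, ε, ζ} : Set (X''.presheaf.stalk x'')) = maximalIdeal (X''.presheaf.stalk x'') ∧
          ∃ U : X''.presheaf.stalk x'', IsUnit U ∧
            (∑ j : Fin p, RatFn.functionFieldMap σ (RatFn.functionFieldMap τ (cc j)) ^ p *
                RatFn.functionFieldMap σ (RatFn.functionFieldMap τ G) ^ (j : ℕ)) =
              RatFn.toFunctionField x'' (U * ε ^ (∑ k, a k) * E ^ (a k₁ + a k₂ + ∑ k, a k)) ∧
            (CleanPermissibleAt p (RatFn.toFunctionField x'') (RatFn.functionFieldMap σ (RatFn.functionFieldMap τ G))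
                (Ideal.span ({ε, ζ} : Set (X''.presheaf.stalk x''))) ∨
              (p ∣ ∑ k, a k ∧ p ∣ a k₁ + a k₂ + ∑ k, a k ∧
                ¬ ((∀ c' : X''.presheaf.stalk x'', U - c' ^ p ∉ maximalIdeal (X''.presheaf.stalk x'')) ∨
                  (∃ c' : X''.presheaf.stalk x'', U - c' ^ p ∈ maximalIdeal (X''.presheaf.stalk x'') ∧
                    U - c' ^ p ∉ Ideal.span ({ε, ζ} : Set (X''.presheaf.stalk x'')) ⊔ maximalIdeal (X''.presheaf.stalk x'') ^ 2) ∨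
                  (∃ c' : X''.presheaf.stalk x'', U - c' ^ p ∈ Ideal.span ({ε, ζ} : Set (X''.presheaf.stalk x'')) ∧
                    U - c' ^ p ∉ maximalIdeal (X''.presheaf.stalk x'') ^ 2))))) ∨
      -- BIRTH at `x'`, and what the insertion leaves at `x''`
      (p ∣ ∑ k, a k ∧
        (∀ k, a k ≠ 0 → Ideal.span {(τ.stalkMap (σ x'')).hom (c k)} = (maximalIdeal (X.presheaf.stalk (τ (σ x'')))).map (τ.stalkMap (σ x'')).hom) ∧
        ∃ U : X'.presheaf.stalk (σ x''), IsUnit U ∧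
          (∑ j : Fin p, RatFn.functionFieldMap τ (cc j) ^ p * RatFn.functionFieldMap τ G ^ (j : ℕ)) =
            RatFn.toFunctionField (σ x'') (U * e' ^ (∑ k, a k)) ∧
          ¬ ((∀ c' : X'.presheaf.stalk (σ x''), U - c' ^ p ∉ maximalIdeal (X'.presheaf.stalk (σ x''))) ∨
            (∃ c' : X'.presheaf.stalk (σ x''), U - c' ^ p ∈ maximalIdeal (X'.presheaf.stalk (σ x'')) ∧
              U - c' ^ p ∉ Ideal.span ({e', y'} : Set (X'.presheaf.stalk (σ x''))) ⊔ maximalIdeal (X'.presheaf.stalk (σ x'')) ^ 2) ∨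
            (∃ c' : X'.presheaf.stalk (σ x''), U - c' ^ p ∈ Ideal.span ({e', y'} : Set (X'.presheaf.stalk (σ x''))) ∧
              U - c' ^ p ∉ maximalIdeal (X'.presheaf.stalk (σ x'')) ^ 2)) ∧
          Ideal.span ({E, ε, ζ} : Set (X''.presheaf.stalk x'')) = maximalIdeal (X''.presheaf.stalk x'') ∧
          (∑ j : Fin p, RatFn.functionFieldMap σ (RatFn.functionFieldMap τ (cc j)) ^ p *
              RatFn.functionFieldMap σ (RatFn.functionFieldMap τ G) ^ (j : ℕ)) =
            RatFn.toFunctionField x'' ((σ.stalkMap x'').hom U * ε ^ (∑ k, a k) * E ^ (∑ k, a k)) ∧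
          (CleanPermissibleAt p (RatFn.toFunctionField x'') (RatFn.functionFieldMap σ (RatFn.functionFieldMap τ G))
              (Ideal.span ({ε, ζ} : Set (X''.presheaf.stalk x''))) ∨
            ¬ ((∀ c' : X''.presheaf.stalk x'', (σ.stalkMap x'').hom U - c' ^ p ∉ maximalIdeal (X''.presheaf.stalk x'')) ∨
              (∃ c' : X''.presheaf.stalk x'', (σ.stalkMap x'').hom U - c' ^ p ∈ maximalIdeal (X''.presheaf.stalk x'') ∧
                (σ.stalkMap x'').hom U - c' ^ p ∉ Ideal.span ({ε, ζ} : Set (X''.presheaf.stalk x'')) ⊔ maximalIdeal (X''.presheaf.stalk x'') ^ 2) ∨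
              (∃ c' : X''.presheaf.stalk x'', (σ.stalkMap x'').hom U - c' ^ p ∈ Ideal.span ({ε, ζ} : Set (X''.presheaf.stalk x'')) ∧
                (σ.stalkMap x'').hom U - c' ^ p ∉ maximalIdeal (X''.presheaf.stalk x'') ^ 2))))) := by
  classical
  haveI : CharP X'.functionField p := charP_of_injective_ringHom (RatFn.functionFieldMap τ).injective p
  haveI : CharP X''.functionField p := charP_of_injective_ringHom (RatFn.functionFieldMap σ).injective p
  obtain ⟨hR, n, c, cc, u, a, hc, hdim, hcc, hu, hall, hrep⟩ := exists_cleanRegAt_normalForm p (RatFn.toFunctionField (τ (σ x''))) hclean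
  have hn : n = 3 := by
    have h1 := hdim.symm.trans hdim3
    exact_mod_cast h1
  subst hn
  -- the coefficients of `t_{j₀}`, the third parameter at `x'`, `y' ∈ 𝔪'`
  have hy𝔪 : t j₀ ∈ Ideal.span (Set.range c) := hc ▸ hspan ▸ Ideal.subset_span ⟨j₀, rfl⟩
  obtain ⟨m, hm⟩ := Ideal.mem_span_range_iff_exists_fun.mp hy𝔪
  obtain ⟨z', hzz⟩ := exists_span_triple_eq_of_isRsopPart_pair hpair hdim'
  have hy'm : y' ∈ maximalIdeal (X'.presheaf.stalk (σ x'')) := by simpa using hpair.mem_maximalIdeal 1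
  have hR' : IsRegularLocalRing (X'.presheaf.stalk (σ x'')) := hpair.isRegularLocalRing
  -- the form-(1) currency with `w = ∅`
  have hz0 : Ideal.span (Set.range (Fin.append c Fin.elim0)) = maximalIdeal (X.presheaf.stalk (τ (σ x''))) := by
    rw [span_range_append_elim0_eq, hc]
  have hdim0 : ringKrullDim (X.presheaf.stalk (τ (σ x''))) = ((3 + 0 : ℕ) : WithBot ℕ∞) := by rw [Nat.add_zero]; exact hdim
  have hcJ : Ideal.span (Set.range c) = stalkIdeal J (τ (σ x'')) := hc.trans hJ.symm
  have hrep0 : (∑ j : Fin p, cc j ^ p * G ^ (j : ℕ)) = RatFn.toFunctionField (τ (σ x''))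
      (u * (∏ k, c k ^ a k) * ∏ m' : Fin 0, (Fin.elim0 m' : X.presheaf.stalk (τ (σ x''))) ^ (Fin.elim0 m' : ℕ)) := by
    rw [hrep, Fin.prod_univ_zero, mul_one]
  have he'J : Ideal.span {e'} = (stalkIdeal J (τ (σ x''))).map (τ.stalkMap (σ x'')).hom := by rw [hJ]; exact he'
  refine ⟨c, cc, u, a, m, hc, hcc, hu, hall, hrep, hm.symm, ?_⟩
  rcases cleanPermissibleAt_nearLine_or_corner_or_birth hτ (σ x'') hR c Fin.elim0 hz0 hdim0 hcJ hJ hcc hu hrep0 (fun m' => m'.elim0) hall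
      hdim' t hspan hdimd j₀ he'J hy' hy'm hzz with h | ⟨k₁, k₂, s₁, s₂, hk, ha₁, ha₂, hs₁, hs₂, hss, hs₁N, hs₂N⟩ | ⟨hA, hsides, U, hU, hrepU, hnb⟩
  · exact Or.inl h
  · -- VERTEX at `x'`
    right; left
    have hs₁m : s₁ ∈ maximalIdeal (X'.presheaf.stalk (σ x'')) := hss ▸ Ideal.subset_span (by simp)
    have hs₂m : s₂ ∈ maximalIdeal (X'.presheaf.stalk (σ x'')) := hss ▸ Ideal.subset_span (by simp)
    obtain ⟨-, -, -, hEεζ, -, -, U, hU, hrepU, hfin⟩ :=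
      cleanPermissibleAt_nearLine_insertion_of_vertex_or_birth hτ hσ x'' hR c hc hdim hJ hcc hu a hrep hdim' hJ' t hspan hdimd j₀ he' hy'
        hy'm hzz hk hs₁ hs₂ hs₁m hs₂m hs₁N hs₂N hdim'' hE hε hεm hζ hζm
    exact ⟨k₁, k₂, s₁, s₂, hk, ha₁, ha₂, hs₁, hs₂, hss, hs₁N, hs₂N, hEεζ, U, hU, hrepU, hfin⟩
  · -- BIRTH at `x'`
    right; right
    have hsides' : ∀ k, a k ≠ 0 →
        Ideal.span {(τ.stalkMap (σ x'')).hom (c k)} = (maximalIdeal (X.presheaf.stalk (τ (σ x'')))).map (τ.stalkMap (σ x'')).hom := by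
      intro k hk; rw [hsides k hk, hJ]
    obtain ⟨hcc', -⟩ := rep_functionFieldMap (σ x'') hcc hrep0
    have hdim'3 : ringKrullDim (X'.presheaf.stalk (σ x'')) = (3 : ℕ) := by rw [hdim']; norm_cast
    obtain ⟨hEεζ, hrep'', hfin⟩ :=
      cleanPermissibleAt_strictTransform_of_unitForm_or_birth hσ x'' hR' hdim'3 hJ' hzz hcc' hU (∑ k, a k) hrepU hdim'' hE hε hεm hζ hζm
    refine ⟨hA, hsides', U, hU, hrepU, hnb, hEεζ, hrep'', ?_⟩
    rcases hfin with h | ⟨-, h⟩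
    · exact Or.inl h
    · exact Or.inr h

end Scheme

end Summit.ResolutionOfSingularities.ResolutionOfSingularities.Theorems.RadicialJung.CleanModels

end
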